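import Summits.CriticalPhenomena.PercolationContinuityZ3.Theorems.PercNearOneGluingNoHeavyLowerTailClubPsiAllWeights
import Summits.CriticalPhenomena.PercolationContinuityZ3.Theorems.PercNearOneGluingNoHeavyLowerTailKNQuestion9ThreeRelays
import HarnessLib

/-!
# `NoHeavyLowerTail` (stmt-CriticalPhenomena-4575) — HEXAGON law-level rows, kernel: the CLUB-Ψ / glued-GΨ₃ functionals
# evaluated at the three balanced relay test functions

Support file (certificate seat `prim-cert-1`, gen 7; `--supports stmt-CriticalPhenomena-4575`, crux closed).  No definitions,
no named facts, no sorries.  Companion: `…HexagonRows.lean` (the six law-level inequalities `S0, S0ᵍ, S1′, S1, S2′, S2` of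
prim-cplus-coupling A5-COUPLING-gen15 §5 as corollaries).
Setting: one finite weighted graph (`μ = prodBernoulli w`), observer SET `N`, ports `x, y`, witness `z`; `Ov = {N ↔ v}`,
`Ēv = {N ↮ v}`, `J' = (Ox ∪ Oy) ∩ Ēz`, `E = Ēx ∩ Ēy ∩ Ēz`, `W1 = Ox ∩ Ēy ∩ Ēz`, `W2 = Oy ∩ Ēx ∩ Ēz`, `E1 = {x↮y, x↮z}`,
`E2 = {y↮x, y↮z}`, `E3 = {z↮x, z↮y}`, `A1 = {x↔y, x↮z}`, `B3 = {z↔y, z↮x}`.  Functionals on monotone `F : Set V → ℝ`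
(coupling seat, A5-COUPLING-gen13/15/16): `K_x(F) = ∫_{J'}[F(C_N) − F(C_z)] + ∫_E[F(C_x) − F(C_z)]` (CLUB-Ψ(x), theorem
`ClubPsi.clubPsi_allWeights`) and `G(F) = ∫_{J'}[F(C_N) − F(C_z)]` (glued GΨ₃, theorem `Q7Psi.gpsi_three_glued`), both `≥ 0` when
`Dx(F) = E F(C_x) − E F(C_z) ≥ 0` and `Dy(F) = E F(C_y) − E F(C_z) ≥ 0`.  This file: closed forms of `Dx, Dy, K_x, G` at
  `F0 = α·1{y∨z ∈ ·} + β·1{x∨z ∈ ·} + γ·1{x∨y ∈ ·}`,  `F1 = γ·1{x∧y ∈ ·} + α·1{y∨z ∈ ·} + β·1{x∨z ∈ ·}`,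
  `F2 = γ·1{x∨y ∈ ·} + α·1{y∧z ∈ ·} + β·1{x∨z ∈ ·}`   (`α, β, γ ∈ ℝ`),
by finite weighted sums (`BHK2006.integral_prodBernoulli_eq_sum`) and ONE pointwise case analysis on the six connection
predicates `N↔x, N↔y, N↔z, x↔y, x↔z, y↔z` (inconsistent branches discarded by transitivity, `closure_facts`).
-/

namespace Summit.CriticalPhenomena.PercolationContinuityZ3.Theorems

open MeasureTheory Set Literature.Probability.LatticeModels Literature.Probability.Percolation
open scoped Classical
open KNPreFKG BHK2006 DecisionTree LonePortSum LonePortSumGeneral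

noncomputable section

namespace HexagonRows

universe u

variable {V : Type u} [Fintype V]

omit [Fintype V] in
/-- Membership in a cluster is reachability. [folklore] -/
theorem mem_openCluster_iff' {ω : BondConfig V} {a v : V} : v ∈ openCluster ω a ↔ (openGraph ω).Reachable a v := Iff.rfl

omit [Fintype V] in
/-- Membership in the glued cluster `C_N = ⋃_{n ∈ N} C_n`. [folklore] -/
theorem mem_clusterN_iff {ω : BondConfig V} {N : Set V} {v : V} :
    (v ∈ ⋃ n ∈ N, openCluster ω n) ↔ ∃ n ∈ N, (openGraph ω).Reachable v n := by
  simp only [Set.mem_iUnion, mem_openCluster_iff', exists_prop]; exact exists_congr fun n => and_congr_right fun _ => ⟨.symm, .symm⟩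

omit [Fintype V] in
/-- `N ↔ a` and `a ↔ b` give `N ↔ b`. [folklore] -/
theorem reachN_trans {ω : BondConfig V} {N : Set V} {a b : V} (hab : (openGraph ω).Reachable a b)
    (ha : ∃ n ∈ N, (openGraph ω).Reachable a n) : ∃ n ∈ N, (openGraph ω).Reachable b n :=
  ha.imp fun _ ⟨hn, h⟩ => ⟨hn, hab.symm.trans h⟩

omit [Fintype V] in
/-- `{N ↮ v}` is the complement of `{N ↔ v}`. [folklore] -/
theorem forall_not_reach_iff {ω : BondConfig V} {N : Set V} {v : V} :
    (∀ n ∈ N, ¬ (openGraph ω).Reachable v n) ↔ ¬ ∃ n ∈ N, (openGraph ω).Reachable v n := by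
  simp only [not_exists, not_and]

section Pointwise

variable (x y z : V) (N : Set V) (ω : BondConfig V)

omit [Fintype V] in
/-- The closure (transitivity) facts used to discard inconsistent branches of the case analysis. [folklore] -/
theorem closure_facts :
    ((openGraph ω).Reachable x y → (∃ n ∈ N, (openGraph ω).Reachable x n) → ∃ n ∈ N, (openGraph ω).Reachable y n) ∧
    ((openGraph ω).Reachable x y → (∃ n ∈ N, (openGraph ω).Reachable y n) → ∃ n ∈ N, (openGraph ω).Reachable x n) ∧
    ((openGraph ω).Reachable x z → (∃ n ∈ N, (openGraph ω).Reachable x n) → ∃ n ∈ N, (openGraph ω).Reachable z n) ∧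
    ((openGraph ω).Reachable x z → (∃ n ∈ N, (openGraph ω).Reachable z n) → ∃ n ∈ N, (openGraph ω).Reachable x n) ∧
    ((openGraph ω).Reachable y z → (∃ n ∈ N, (openGraph ω).Reachable y n) → ∃ n ∈ N, (openGraph ω).Reachable z n) ∧
    ((openGraph ω).Reachable y z → (∃ n ∈ N, (openGraph ω).Reachable z n) → ∃ n ∈ N, (openGraph ω).Reachable y n) ∧
    ((openGraph ω).Reachable x y → (openGraph ω).Reachable x z → (openGraph ω).Reachable y z) ∧
    ((openGraph ω).Reachable x y → (openGraph ω).Reachable y z → (openGraph ω).Reachable x z) ∧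
    ((openGraph ω).Reachable x z → (openGraph ω).Reachable y z → (openGraph ω).Reachable x y) :=
  ⟨fun h hx => reachN_trans h hx, fun h hy => reachN_trans h.symm hy, fun h hx => reachN_trans h hx,
    fun h hz => reachN_trans h.symm hz, fun h hy => reachN_trans h hy, fun h hz => reachN_trans h.symm hz,
    fun h1 h2 => h1.symm.trans h2, fun h1 h2 => h1.trans h2, fun h1 h2 => h1.trans h2.symm⟩

end Pointwise

/-! ## Evaluation of the functionals at `F0 = α·1{y∨z} + β·1{x∨z} + γ·1{x∨y}` -/

set_option linter.unusedSimpArgs false in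
/-- **`F0`: closed forms.**  With `F0 S = α·1{y ∈ S ∨ z ∈ S} + β·1{x ∈ S ∨ z ∈ S} + γ·1{x ∈ S ∨ y ∈ S}` (the sets are
passed as arguments fixed by their defining equations): `Dx(F0) = γ μ(E3) − α μ(E1)`, `Dy(F0) = γ μ(E3) − β μ(E2)`,
`K_x(F0) = γ μ(Ēz ∩ E3) − α μ(Ēy ∩ Ēz ∩ E1) − β μ(W2)`, `G(F0) = γ μ(J' ∩ E3) − α μ(W1) − β μ(W2)`. [this work] -/
theorem eval_F0 (w : Sym2 V → unitInterval) (x y z : V) (N : Set V) (α β γ : ℝ) (F : Set V → ℝ)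
    (hF : F = fun S =>
      α * (if y ∈ S ∨ z ∈ S then 1 else 0) + β * (if x ∈ S ∨ z ∈ S then 1 else 0) + γ * (if x ∈ S ∨ y ∈ S then 1 else 0))
    (Ox Oy Ex Ey Ez E1 E2 E3 : Set (BondConfig V))
    (hOx : Ox = {ω | ∃ n ∈ N, (openGraph ω).Reachable x n}) (hOy : Oy = {ω | ∃ n ∈ N, (openGraph ω).Reachable y n})
    (hEx : Ex = {ω | ∀ n ∈ N, ¬ (openGraph ω).Reachable x n}) (hEy : Ey = {ω | ∀ n ∈ N, ¬ (openGraph ω).Reachable y n})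
    (hEz : Ez = {ω | ∀ n ∈ N, ¬ (openGraph ω).Reachable z n})
    (hE1 : E1 = {ω | ¬ (openGraph ω).Reachable x y} ∩ {ω | ¬ (openGraph ω).Reachable x z})
    (hE2 : E2 = {ω | ¬ (openGraph ω).Reachable y x} ∩ {ω | ¬ (openGraph ω).Reachable y z})
    (hE3 : E3 = {ω | ¬ (openGraph ω).Reachable z x} ∩ {ω | ¬ (openGraph ω).Reachable z y}) :
    ((∫ ω, F (openCluster ω x) ∂(prodBernoulli w)) - ∫ ω, F (openCluster ω z) ∂(prodBernoulli w) =
        γ * (prodBernoulli w).real E3 - α * (prodBernoulli w).real E1) ∧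
    ((∫ ω, F (openCluster ω y) ∂(prodBernoulli w)) - ∫ ω, F (openCluster ω z) ∂(prodBernoulli w) =
        γ * (prodBernoulli w).real E3 - β * (prodBernoulli w).real E2) ∧
    ((∫ ω in (Ox ∪ Oy) ∩ Ez, F (⋃ n ∈ N, openCluster ω n) ∂(prodBernoulli w)) -
          (∫ ω in (Ox ∪ Oy) ∩ Ez, F (openCluster ω z) ∂(prodBernoulli w)) +
        ((∫ ω in Ex ∩ (Ey ∩ Ez), F (openCluster ω x) ∂(prodBernoulli w)) -
          ∫ ω in Ex ∩ (Ey ∩ Ez), F (openCluster ω z) ∂(prodBernoulli w)) =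
      γ * (prodBernoulli w).real (Ez ∩ E3) - α * (prodBernoulli w).real ((Ey ∩ Ez) ∩ E1) -
        β * (prodBernoulli w).real (Oy ∩ (Ex ∩ Ez))) ∧
    ((∫ ω in (Ox ∪ Oy) ∩ Ez, F (⋃ n ∈ N, openCluster ω n) ∂(prodBernoulli w)) -
          (∫ ω in (Ox ∪ Oy) ∩ Ez, F (openCluster ω z) ∂(prodBernoulli w)) =
      γ * (prodBernoulli w).real (((Ox ∪ Oy) ∩ Ez) ∩ E3) - α * (prodBernoulli w).real (Ox ∩ (Ey ∩ Ez)) -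
        β * (prodBernoulli w).real (Oy ∩ (Ex ∩ Ez))) := by
  set wt : BondConfig V → ℝ := weight (fun e => (w e : ℝ)) with hwt
  -- pointwise values
  have pw : ∀ ω : BondConfig V,
      (F (openCluster ω x) - F (openCluster ω z) = γ * ind E3 ω - α * ind E1 ω) ∧
      (F (openCluster ω y) - F (openCluster ω z) = γ * ind E3 ω - β * ind E2 ω) ∧
      ((F (⋃ n ∈ N, openCluster ω n) - F (openCluster ω z)) * ind ((Ox ∪ Oy) ∩ Ez) ω +
          (F (openCluster ω x) - F (openCluster ω z)) * ind (Ex ∩ (Ey ∩ Ez)) ω =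
        γ * ind (Ez ∩ E3) ω - α * ind ((Ey ∩ Ez) ∩ E1) ω - β * ind (Oy ∩ (Ex ∩ Ez)) ω) ∧
      ((F (⋃ n ∈ N, openCluster ω n) - F (openCluster ω z)) * ind ((Ox ∪ Oy) ∩ Ez) ω =
        γ * ind (((Ox ∪ Oy) ∩ Ez) ∩ E3) ω - α * ind (Ox ∩ (Ey ∩ Ez)) ω - β * ind (Oy ∩ (Ex ∩ Ez)) ω) := by
    intro ω
    have cf := closure_facts x y z N ω
    have syx : (openGraph ω).Reachable y x ↔ (openGraph ω).Reachable x y := ⟨fun h => h.symm, fun h => h.symm⟩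
    have szx : (openGraph ω).Reachable z x ↔ (openGraph ω).Reachable x z := ⟨fun h => h.symm, fun h => h.symm⟩
    have szy : (openGraph ω).Reachable z y ↔ (openGraph ω).Reachable y z := ⟨fun h => h.symm, fun h => h.symm⟩
    have rxx : (openGraph ω).Reachable x x := SimpleGraph.Reachable.refl x
    have ryy : (openGraph ω).Reachable y y := SimpleGraph.Reachable.refl y
    have rzz : (openGraph ω).Reachable z z := SimpleGraph.Reachable.refl z
    subst hF hOx hOy hEx hEy hEz hE1 hE2 hE3
    refine ⟨?_, ?_, ?_, ?_⟩ <;>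
    by_cases hPx : ∃ n ∈ N, (openGraph ω).Reachable x n <;> by_cases hPy : ∃ n ∈ N, (openGraph ω).Reachable y n <;>
      by_cases hPz : ∃ n ∈ N, (openGraph ω).Reachable z n <;> by_cases hxy : (openGraph ω).Reachable x y <;>
      by_cases hxz : (openGraph ω).Reachable x z <;> by_cases hyz : (openGraph ω).Reachable y z
    all_goals first
      | exact absurd (cf.1 hxy hPx) hPy
      | exact absurd (cf.2.1 hxy hPy) hPx
      | exact absurd (cf.2.2.1 hxz hPx) hPz
      | exact absurd (cf.2.2.2.1 hxz hPz) hPx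
      | exact absurd (cf.2.2.2.2.1 hyz hPy) hPz
      | exact absurd (cf.2.2.2.2.2.1 hyz hPz) hPy
      | exact absurd (cf.2.2.2.2.2.2.1 hxy hxz) hyz
      | exact absurd (cf.2.2.2.2.2.2.2.1 hxy hyz) hxz
      | exact absurd (cf.2.2.2.2.2.2.2.2 hxz hyz) hxy
      | (simp only [ind, Set.mem_inter_iff, Set.mem_union, Set.mem_setOf_eq,
          mem_clusterN_iff, mem_openCluster_iff', forall_not_reach_iff, syx, szx, szy, hPx, hPy, hPz, hxy, hxz, hyz,
          rxx, ryy, rzz, true_or, or_true, or_false, false_or, true_and, and_true, and_false, false_and, not_true_eq_false,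
          not_false_eq_true, if_true, if_false]
         ring)
  refine ⟨?_, ?_, ?_, ?_⟩
  · rw [integral_prodBernoulli_eq_sum, integral_prodBernoulli_eq_sum, measureReal_eq_sum w E3, measureReal_eq_sum w E1,
      ← Finset.sum_sub_distrib, Finset.mul_sum, Finset.mul_sum, ← Finset.sum_sub_distrib]
    refine Finset.sum_congr rfl fun ω _ => ?_
    rw [← mul_sub, (pw ω).1]; ring
  · rw [integral_prodBernoulli_eq_sum, integral_prodBernoulli_eq_sum, measureReal_eq_sum w E3, measureReal_eq_sum w E2,
      ← Finset.sum_sub_distrib, Finset.mul_sum, Finset.mul_sum, ← Finset.sum_sub_distrib]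
    refine Finset.sum_congr rfl fun ω _ => ?_
    rw [← mul_sub, (pw ω).2.1]; ring
  · rw [setIntegral_eq_sum w, setIntegral_eq_sum w, setIntegral_eq_sum w, setIntegral_eq_sum w,
      measureReal_eq_sum w (Ez ∩ E3), measureReal_eq_sum w ((Ey ∩ Ez) ∩ E1), measureReal_eq_sum w (Oy ∩ (Ex ∩ Ez)),
      Finset.mul_sum, Finset.mul_sum, Finset.mul_sum, ← Finset.sum_sub_distrib, ← Finset.sum_sub_distrib,
      ← Finset.sum_add_distrib, ← Finset.sum_sub_distrib, ← Finset.sum_sub_distrib]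
    refine Finset.sum_congr rfl fun ω _ => ?_
    have h := (pw ω).2.2.1
    calc wt ω * (F (⋃ n ∈ N, openCluster ω n) * ind ((Ox ∪ Oy) ∩ Ez) ω) -
          wt ω * (F (openCluster ω z) * ind ((Ox ∪ Oy) ∩ Ez) ω) +
          (wt ω * (F (openCluster ω x) * ind (Ex ∩ (Ey ∩ Ez)) ω) - wt ω * (F (openCluster ω z) * ind (Ex ∩ (Ey ∩ Ez)) ω))
        = wt ω * ((F (⋃ n ∈ N, openCluster ω n) - F (openCluster ω z)) * ind ((Ox ∪ Oy) ∩ Ez) ω +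
            (F (openCluster ω x) - F (openCluster ω z)) * ind (Ex ∩ (Ey ∩ Ez)) ω) := by ring
      _ = wt ω * (γ * ind (Ez ∩ E3) ω - α * ind ((Ey ∩ Ez) ∩ E1) ω - β * ind (Oy ∩ (Ex ∩ Ez)) ω) := by rw [h]
      _ = γ * (wt ω * ind (Ez ∩ E3) ω) - α * (wt ω * ind ((Ey ∩ Ez) ∩ E1) ω) - β * (wt ω * ind (Oy ∩ (Ex ∩ Ez)) ω) := by
          ring
  · rw [setIntegral_eq_sum w, setIntegral_eq_sum w, measureReal_eq_sum w (((Ox ∪ Oy) ∩ Ez) ∩ E3),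
      measureReal_eq_sum w (Ox ∩ (Ey ∩ Ez)), measureReal_eq_sum w (Oy ∩ (Ex ∩ Ez)),
      Finset.mul_sum, Finset.mul_sum, Finset.mul_sum, ← Finset.sum_sub_distrib, ← Finset.sum_sub_distrib,
      ← Finset.sum_sub_distrib]
    refine Finset.sum_congr rfl fun ω _ => ?_
    have h := (pw ω).2.2.2
    calc wt ω * (F (⋃ n ∈ N, openCluster ω n) * ind ((Ox ∪ Oy) ∩ Ez) ω) -
          wt ω * (F (openCluster ω z) * ind ((Ox ∪ Oy) ∩ Ez) ω)
        = wt ω * ((F (⋃ n ∈ N, openCluster ω n) - F (openCluster ω z)) * ind ((Ox ∪ Oy) ∩ Ez) ω) := by ring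
      _ = wt ω * (γ * ind (((Ox ∪ Oy) ∩ Ez) ∩ E3) ω - α * ind (Ox ∩ (Ey ∩ Ez)) ω - β * ind (Oy ∩ (Ex ∩ Ez)) ω) := by rw [h]
      _ = γ * (wt ω * ind (((Ox ∪ Oy) ∩ Ez) ∩ E3) ω) - α * (wt ω * ind (Ox ∩ (Ey ∩ Ez)) ω) -
            β * (wt ω * ind (Oy ∩ (Ex ∩ Ez)) ω) := by ring

set_option linter.unusedSimpArgs false in
/-- **`F1`: closed forms.**  With `F1 S = γ·1{x ∈ S ∧ y ∈ S} + α·1{y ∈ S ∨ z ∈ S} + β·1{x ∈ S ∨ z ∈ S}`, `A1 = {x↔y, x↮z}`: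
`Dx(F1) = γ μ(A1) − α μ(E1)`, `Dy(F1) = γ μ(A1) − β μ(E2)`,
`K_x(F1) = γ (μ(Ox ∩ Oy ∩ Ēz) + μ(E ∩ A1)) − α μ(Ēy ∩ Ēz ∩ E1) − β μ(W2)`, `G(F1) = γ μ(Ox ∩ Oy ∩ Ēz) − α μ(W1) − β μ(W2)`. [this work] -/
theorem eval_F1 (w : Sym2 V → unitInterval) (x y z : V) (N : Set V) (α β γ : ℝ) (F : Set V → ℝ)
    (hF : F = fun S =>
      γ * (if x ∈ S ∧ y ∈ S then 1 else 0) + α * (if y ∈ S ∨ z ∈ S then 1 else 0) + β * (if x ∈ S ∨ z ∈ S then 1 else 0))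
    (Ox Oy Ex Ey Ez E1 E2 A1 : Set (BondConfig V))
    (hOx : Ox = {ω | ∃ n ∈ N, (openGraph ω).Reachable x n}) (hOy : Oy = {ω | ∃ n ∈ N, (openGraph ω).Reachable y n})
    (hEx : Ex = {ω | ∀ n ∈ N, ¬ (openGraph ω).Reachable x n}) (hEy : Ey = {ω | ∀ n ∈ N, ¬ (openGraph ω).Reachable y n})
    (hEz : Ez = {ω | ∀ n ∈ N, ¬ (openGraph ω).Reachable z n})
    (hE1 : E1 = {ω | ¬ (openGraph ω).Reachable x y} ∩ {ω | ¬ (openGraph ω).Reachable x z})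
    (hE2 : E2 = {ω | ¬ (openGraph ω).Reachable y x} ∩ {ω | ¬ (openGraph ω).Reachable y z})
    (hA1 : A1 = openConn x y ∩ {ω | ¬ (openGraph ω).Reachable x z}) :
    ((∫ ω, F (openCluster ω x) ∂(prodBernoulli w)) - ∫ ω, F (openCluster ω z) ∂(prodBernoulli w) =
        γ * (prodBernoulli w).real A1 - α * (prodBernoulli w).real E1) ∧
    ((∫ ω, F (openCluster ω y) ∂(prodBernoulli w)) - ∫ ω, F (openCluster ω z) ∂(prodBernoulli w) =
        γ * (prodBernoulli w).real A1 - β * (prodBernoulli w).real E2) ∧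
    ((∫ ω in (Ox ∪ Oy) ∩ Ez, F (⋃ n ∈ N, openCluster ω n) ∂(prodBernoulli w)) -
          (∫ ω in (Ox ∪ Oy) ∩ Ez, F (openCluster ω z) ∂(prodBernoulli w)) +
        ((∫ ω in Ex ∩ (Ey ∩ Ez), F (openCluster ω x) ∂(prodBernoulli w)) -
          ∫ ω in Ex ∩ (Ey ∩ Ez), F (openCluster ω z) ∂(prodBernoulli w)) =
      γ * ((prodBernoulli w).real (Ox ∩ (Oy ∩ Ez)) + (prodBernoulli w).real ((Ex ∩ (Ey ∩ Ez)) ∩ A1)) -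
        α * (prodBernoulli w).real ((Ey ∩ Ez) ∩ E1) - β * (prodBernoulli w).real (Oy ∩ (Ex ∩ Ez))) ∧
    ((∫ ω in (Ox ∪ Oy) ∩ Ez, F (⋃ n ∈ N, openCluster ω n) ∂(prodBernoulli w)) -
          (∫ ω in (Ox ∪ Oy) ∩ Ez, F (openCluster ω z) ∂(prodBernoulli w)) =
      γ * (prodBernoulli w).real (Ox ∩ (Oy ∩ Ez)) - α * (prodBernoulli w).real (Ox ∩ (Ey ∩ Ez)) -
        β * (prodBernoulli w).real (Oy ∩ (Ex ∩ Ez))) := by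
  set wt : BondConfig V → ℝ := weight (fun e => (w e : ℝ)) with hwt
  -- pointwise values
  have pw : ∀ ω : BondConfig V,
      (F (openCluster ω x) - F (openCluster ω z) = γ * ind A1 ω - α * ind E1 ω) ∧
      (F (openCluster ω y) - F (openCluster ω z) = γ * ind A1 ω - β * ind E2 ω) ∧
      ((F (⋃ n ∈ N, openCluster ω n) - F (openCluster ω z)) * ind ((Ox ∪ Oy) ∩ Ez) ω +
          (F (openCluster ω x) - F (openCluster ω z)) * ind (Ex ∩ (Ey ∩ Ez)) ω =
        γ * (ind (Ox ∩ (Oy ∩ Ez)) ω + ind ((Ex ∩ (Ey ∩ Ez)) ∩ A1) ω) - α * ind ((Ey ∩ Ez) ∩ E1) ω -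
          β * ind (Oy ∩ (Ex ∩ Ez)) ω) ∧
      ((F (⋃ n ∈ N, openCluster ω n) - F (openCluster ω z)) * ind ((Ox ∪ Oy) ∩ Ez) ω =
        γ * ind (Ox ∩ (Oy ∩ Ez)) ω - α * ind (Ox ∩ (Ey ∩ Ez)) ω - β * ind (Oy ∩ (Ex ∩ Ez)) ω) := by
    intro ω
    have cf := closure_facts x y z N ω
    have syx : (openGraph ω).Reachable y x ↔ (openGraph ω).Reachable x y := ⟨fun h => h.symm, fun h => h.symm⟩
    have szx : (openGraph ω).Reachable z x ↔ (openGraph ω).Reachable x z := ⟨fun h => h.symm, fun h => h.symm⟩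
    have szy : (openGraph ω).Reachable z y ↔ (openGraph ω).Reachable y z := ⟨fun h => h.symm, fun h => h.symm⟩
    have rxx : (openGraph ω).Reachable x x := SimpleGraph.Reachable.refl x
    have ryy : (openGraph ω).Reachable y y := SimpleGraph.Reachable.refl y
    have rzz : (openGraph ω).Reachable z z := SimpleGraph.Reachable.refl z
    subst hF hOx hOy hEx hEy hEz hE1 hE2 hA1
    refine ⟨?_, ?_, ?_, ?_⟩ <;>
    by_cases hPx : ∃ n ∈ N, (openGraph ω).Reachable x n <;> by_cases hPy : ∃ n ∈ N, (openGraph ω).Reachable y n <;>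
      by_cases hPz : ∃ n ∈ N, (openGraph ω).Reachable z n <;> by_cases hxy : (openGraph ω).Reachable x y <;>
      by_cases hxz : (openGraph ω).Reachable x z <;> by_cases hyz : (openGraph ω).Reachable y z
    all_goals first
      | exact absurd (cf.1 hxy hPx) hPy
      | exact absurd (cf.2.1 hxy hPy) hPx
      | exact absurd (cf.2.2.1 hxz hPx) hPz
      | exact absurd (cf.2.2.2.1 hxz hPz) hPx
      | exact absurd (cf.2.2.2.2.1 hyz hPy) hPz
      | exact absurd (cf.2.2.2.2.2.1 hyz hPz) hPy
      | exact absurd (cf.2.2.2.2.2.2.1 hxy hxz) hyz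
      | exact absurd (cf.2.2.2.2.2.2.2.1 hxy hyz) hxz
      | exact absurd (cf.2.2.2.2.2.2.2.2 hxz hyz) hxy
      | (simp only [ind, Set.mem_inter_iff, Set.mem_union, Set.mem_setOf_eq, openConn,
          mem_clusterN_iff, mem_openCluster_iff', forall_not_reach_iff, syx, szx, szy, hPx, hPy, hPz, hxy, hxz, hyz,
          rxx, ryy, rzz, true_or, or_true, or_false, false_or, true_and, and_true, and_false, false_and, not_true_eq_false,
          not_false_eq_true, if_true, if_false]
         ring)
  refine ⟨?_, ?_, ?_, ?_⟩
  · rw [integral_prodBernoulli_eq_sum, integral_prodBernoulli_eq_sum, measureReal_eq_sum w A1, measureReal_eq_sum w E1,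
      ← Finset.sum_sub_distrib, Finset.mul_sum, Finset.mul_sum, ← Finset.sum_sub_distrib]
    refine Finset.sum_congr rfl fun ω _ => ?_
    rw [← mul_sub, (pw ω).1]; ring
  · rw [integral_prodBernoulli_eq_sum, integral_prodBernoulli_eq_sum, measureReal_eq_sum w A1, measureReal_eq_sum w E2,
      ← Finset.sum_sub_distrib, Finset.mul_sum, Finset.mul_sum, ← Finset.sum_sub_distrib]
    refine Finset.sum_congr rfl fun ω _ => ?_
    rw [← mul_sub, (pw ω).2.1]; ring
  · rw [setIntegral_eq_sum w, setIntegral_eq_sum w, setIntegral_eq_sum w, setIntegral_eq_sum w,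
      measureReal_eq_sum w (Ox ∩ (Oy ∩ Ez)), measureReal_eq_sum w ((Ex ∩ (Ey ∩ Ez)) ∩ A1),
      measureReal_eq_sum w ((Ey ∩ Ez) ∩ E1), measureReal_eq_sum w (Oy ∩ (Ex ∩ Ez)), ← Finset.sum_add_distrib,
      Finset.mul_sum, Finset.mul_sum, Finset.mul_sum, ← Finset.sum_sub_distrib, ← Finset.sum_sub_distrib,
      ← Finset.sum_add_distrib, ← Finset.sum_sub_distrib, ← Finset.sum_sub_distrib]
    refine Finset.sum_congr rfl fun ω _ => ?_
    have h := (pw ω).2.2.1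
    calc wt ω * (F (⋃ n ∈ N, openCluster ω n) * ind ((Ox ∪ Oy) ∩ Ez) ω) -
          wt ω * (F (openCluster ω z) * ind ((Ox ∪ Oy) ∩ Ez) ω) +
          (wt ω * (F (openCluster ω x) * ind (Ex ∩ (Ey ∩ Ez)) ω) - wt ω * (F (openCluster ω z) * ind (Ex ∩ (Ey ∩ Ez)) ω))
        = wt ω * ((F (⋃ n ∈ N, openCluster ω n) - F (openCluster ω z)) * ind ((Ox ∪ Oy) ∩ Ez) ω +
            (F (openCluster ω x) - F (openCluster ω z)) * ind (Ex ∩ (Ey ∩ Ez)) ω) := by ring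
      _ = wt ω * (γ * (ind (Ox ∩ (Oy ∩ Ez)) ω + ind ((Ex ∩ (Ey ∩ Ez)) ∩ A1) ω) - α * ind ((Ey ∩ Ez) ∩ E1) ω -
            β * ind (Oy ∩ (Ex ∩ Ez)) ω) := by rw [h]
      _ = γ * (wt ω * ind (Ox ∩ (Oy ∩ Ez)) ω + wt ω * ind ((Ex ∩ (Ey ∩ Ez)) ∩ A1) ω) -
            α * (wt ω * ind ((Ey ∩ Ez) ∩ E1) ω) - β * (wt ω * ind (Oy ∩ (Ex ∩ Ez)) ω) := by ring
  · rw [setIntegral_eq_sum w, setIntegral_eq_sum w, measureReal_eq_sum w (Ox ∩ (Oy ∩ Ez)),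
      measureReal_eq_sum w (Ox ∩ (Ey ∩ Ez)), measureReal_eq_sum w (Oy ∩ (Ex ∩ Ez)),
      Finset.mul_sum, Finset.mul_sum, Finset.mul_sum, ← Finset.sum_sub_distrib, ← Finset.sum_sub_distrib,
      ← Finset.sum_sub_distrib]
    refine Finset.sum_congr rfl fun ω _ => ?_
    have h := (pw ω).2.2.2
    calc wt ω * (F (⋃ n ∈ N, openCluster ω n) * ind ((Ox ∪ Oy) ∩ Ez) ω) -
          wt ω * (F (openCluster ω z) * ind ((Ox ∪ Oy) ∩ Ez) ω)
        = wt ω * ((F (⋃ n ∈ N, openCluster ω n) - F (openCluster ω z)) * ind ((Ox ∪ Oy) ∩ Ez) ω) := by ring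
      _ = wt ω * (γ * ind (Ox ∩ (Oy ∩ Ez)) ω - α * ind (Ox ∩ (Ey ∩ Ez)) ω - β * ind (Oy ∩ (Ex ∩ Ez)) ω) := by rw [h]
      _ = γ * (wt ω * ind (Ox ∩ (Oy ∩ Ez)) ω) - α * (wt ω * ind (Ox ∩ (Ey ∩ Ez)) ω) -
            β * (wt ω * ind (Oy ∩ (Ex ∩ Ez)) ω) := by ring


set_option linter.unusedSimpArgs false in
/-- **`F2`: closed forms.**  With `F2 S = γ·1{x ∈ S ∨ y ∈ S} + α·1{y ∈ S ∧ z ∈ S} + β·1{x ∈ S ∨ z ∈ S}`, `B3 = {z↔y, z↮x}`: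
`Dx(F2) = γ μ(E3) − α μ(B3)`, `Dy(F2) = γ μ(E3) − β μ(E2)`,
`K_x(F2) = γ μ(Ēz ∩ E3) − α μ(Ēz ∩ B3) − β μ(W2)`, `G(F2) = γ μ(J' ∩ E3) − α μ(Ox ∩ Ēz ∩ B3) − β μ(W2)`. [this work] -/
theorem eval_F2 (w : Sym2 V → unitInterval) (x y z : V) (N : Set V) (α β γ : ℝ) (F : Set V → ℝ)
    (hF : F = fun S =>
      γ * (if x ∈ S ∨ y ∈ S then 1 else 0) + α * (if y ∈ S ∧ z ∈ S then 1 else 0) + β * (if x ∈ S ∨ z ∈ S then 1 else 0))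
    (Ox Oy Ex Ey Ez E2 E3 B3 : Set (BondConfig V))
    (hOx : Ox = {ω | ∃ n ∈ N, (openGraph ω).Reachable x n}) (hOy : Oy = {ω | ∃ n ∈ N, (openGraph ω).Reachable y n})
    (hEx : Ex = {ω | ∀ n ∈ N, ¬ (openGraph ω).Reachable x n}) (hEy : Ey = {ω | ∀ n ∈ N, ¬ (openGraph ω).Reachable y n})
    (hEz : Ez = {ω | ∀ n ∈ N, ¬ (openGraph ω).Reachable z n})
    (hE2 : E2 = {ω | ¬ (openGraph ω).Reachable y x} ∩ {ω | ¬ (openGraph ω).Reachable y z})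
    (hE3 : E3 = {ω | ¬ (openGraph ω).Reachable z x} ∩ {ω | ¬ (openGraph ω).Reachable z y})
    (hB3 : B3 = openConn z y ∩ {ω | ¬ (openGraph ω).Reachable z x}) :
    ((∫ ω, F (openCluster ω x) ∂(prodBernoulli w)) - ∫ ω, F (openCluster ω z) ∂(prodBernoulli w) =
        γ * (prodBernoulli w).real E3 - α * (prodBernoulli w).real B3) ∧
    ((∫ ω, F (openCluster ω y) ∂(prodBernoulli w)) - ∫ ω, F (openCluster ω z) ∂(prodBernoulli w) =
        γ * (prodBernoulli w).real E3 - β * (prodBernoulli w).real E2) ∧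
    ((∫ ω in (Ox ∪ Oy) ∩ Ez, F (⋃ n ∈ N, openCluster ω n) ∂(prodBernoulli w)) -
          (∫ ω in (Ox ∪ Oy) ∩ Ez, F (openCluster ω z) ∂(prodBernoulli w)) +
        ((∫ ω in Ex ∩ (Ey ∩ Ez), F (openCluster ω x) ∂(prodBernoulli w)) -
          ∫ ω in Ex ∩ (Ey ∩ Ez), F (openCluster ω z) ∂(prodBernoulli w)) =
      γ * (prodBernoulli w).real (Ez ∩ E3) - α * (prodBernoulli w).real (Ez ∩ B3) -
        β * (prodBernoulli w).real (Oy ∩ (Ex ∩ Ez))) ∧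
    ((∫ ω in (Ox ∪ Oy) ∩ Ez, F (⋃ n ∈ N, openCluster ω n) ∂(prodBernoulli w)) -
          (∫ ω in (Ox ∪ Oy) ∩ Ez, F (openCluster ω z) ∂(prodBernoulli w)) =
      γ * (prodBernoulli w).real (((Ox ∪ Oy) ∩ Ez) ∩ E3) - α * (prodBernoulli w).real ((Ox ∩ Ez) ∩ B3) -
        β * (prodBernoulli w).real (Oy ∩ (Ex ∩ Ez))) := by
  set wt : BondConfig V → ℝ := weight (fun e => (w e : ℝ)) with hwt
  -- pointwise values
  have pw : ∀ ω : BondConfig V,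
      (F (openCluster ω x) - F (openCluster ω z) = γ * ind E3 ω - α * ind B3 ω) ∧
      (F (openCluster ω y) - F (openCluster ω z) = γ * ind E3 ω - β * ind E2 ω) ∧
      ((F (⋃ n ∈ N, openCluster ω n) - F (openCluster ω z)) * ind ((Ox ∪ Oy) ∩ Ez) ω +
          (F (openCluster ω x) - F (openCluster ω z)) * ind (Ex ∩ (Ey ∩ Ez)) ω =
        γ * ind (Ez ∩ E3) ω - α * ind (Ez ∩ B3) ω - β * ind (Oy ∩ (Ex ∩ Ez)) ω) ∧
      ((F (⋃ n ∈ N, openCluster ω n) - F (openCluster ω z)) * ind ((Ox ∪ Oy) ∩ Ez) ω =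
        γ * ind (((Ox ∪ Oy) ∩ Ez) ∩ E3) ω - α * ind ((Ox ∩ Ez) ∩ B3) ω - β * ind (Oy ∩ (Ex ∩ Ez)) ω) := by
    intro ω
    have cf := closure_facts x y z N ω
    have syx : (openGraph ω).Reachable y x ↔ (openGraph ω).Reachable x y := ⟨fun h => h.symm, fun h => h.symm⟩
    have szx : (openGraph ω).Reachable z x ↔ (openGraph ω).Reachable x z := ⟨fun h => h.symm, fun h => h.symm⟩
    have szy : (openGraph ω).Reachable z y ↔ (openGraph ω).Reachable y z := ⟨fun h => h.symm, fun h => h.symm⟩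
    have rxx : (openGraph ω).Reachable x x := SimpleGraph.Reachable.refl x
    have ryy : (openGraph ω).Reachable y y := SimpleGraph.Reachable.refl y
    have rzz : (openGraph ω).Reachable z z := SimpleGraph.Reachable.refl z
    subst hF hOx hOy hEx hEy hEz hE2 hE3 hB3
    refine ⟨?_, ?_, ?_, ?_⟩ <;>
    by_cases hPx : ∃ n ∈ N, (openGraph ω).Reachable x n <;> by_cases hPy : ∃ n ∈ N, (openGraph ω).Reachable y n <;>
      by_cases hPz : ∃ n ∈ N, (openGraph ω).Reachable z n <;> by_cases hxy : (openGraph ω).Reachable x y <;>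
      by_cases hxz : (openGraph ω).Reachable x z <;> by_cases hyz : (openGraph ω).Reachable y z
    all_goals first
      | exact absurd (cf.1 hxy hPx) hPy
      | exact absurd (cf.2.1 hxy hPy) hPx
      | exact absurd (cf.2.2.1 hxz hPx) hPz
      | exact absurd (cf.2.2.2.1 hxz hPz) hPx
      | exact absurd (cf.2.2.2.2.1 hyz hPy) hPz
      | exact absurd (cf.2.2.2.2.2.1 hyz hPz) hPy
      | exact absurd (cf.2.2.2.2.2.2.1 hxy hxz) hyz
      | exact absurd (cf.2.2.2.2.2.2.2.1 hxy hyz) hxz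
      | exact absurd (cf.2.2.2.2.2.2.2.2 hxz hyz) hxy
      | (simp only [ind, Set.mem_inter_iff, Set.mem_union, Set.mem_setOf_eq, openConn,
          mem_clusterN_iff, mem_openCluster_iff', forall_not_reach_iff, syx, szx, szy, hPx, hPy, hPz, hxy, hxz, hyz,
          rxx, ryy, rzz, true_or, or_true, or_false, false_or, true_and, and_true, and_false, false_and, not_true_eq_false,
          not_false_eq_true, if_true, if_false]
         ring)
  refine ⟨?_, ?_, ?_, ?_⟩
  · rw [integral_prodBernoulli_eq_sum, integral_prodBernoulli_eq_sum, measureReal_eq_sum w E3, measureReal_eq_sum w B3,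
      ← Finset.sum_sub_distrib, Finset.mul_sum, Finset.mul_sum, ← Finset.sum_sub_distrib]
    refine Finset.sum_congr rfl fun ω _ => ?_
    rw [← mul_sub, (pw ω).1]; ring
  · rw [integral_prodBernoulli_eq_sum, integral_prodBernoulli_eq_sum, measureReal_eq_sum w E3, measureReal_eq_sum w E2,
      ← Finset.sum_sub_distrib, Finset.mul_sum, Finset.mul_sum, ← Finset.sum_sub_distrib]
    refine Finset.sum_congr rfl fun ω _ => ?_
    rw [← mul_sub, (pw ω).2.1]; ring
  · rw [setIntegral_eq_sum w, setIntegral_eq_sum w, setIntegral_eq_sum w, setIntegral_eq_sum w,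
      measureReal_eq_sum w (Ez ∩ E3), measureReal_eq_sum w (Ez ∩ B3), measureReal_eq_sum w (Oy ∩ (Ex ∩ Ez)),
      Finset.mul_sum, Finset.mul_sum, Finset.mul_sum, ← Finset.sum_sub_distrib, ← Finset.sum_sub_distrib,
      ← Finset.sum_add_distrib, ← Finset.sum_sub_distrib, ← Finset.sum_sub_distrib]
    refine Finset.sum_congr rfl fun ω _ => ?_
    have h := (pw ω).2.2.1
    calc wt ω * (F (⋃ n ∈ N, openCluster ω n) * ind ((Ox ∪ Oy) ∩ Ez) ω) -
          wt ω * (F (openCluster ω z) * ind ((Ox ∪ Oy) ∩ Ez) ω) +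
          (wt ω * (F (openCluster ω x) * ind (Ex ∩ (Ey ∩ Ez)) ω) - wt ω * (F (openCluster ω z) * ind (Ex ∩ (Ey ∩ Ez)) ω))
        = wt ω * ((F (⋃ n ∈ N, openCluster ω n) - F (openCluster ω z)) * ind ((Ox ∪ Oy) ∩ Ez) ω +
            (F (openCluster ω x) - F (openCluster ω z)) * ind (Ex ∩ (Ey ∩ Ez)) ω) := by ring
      _ = wt ω * (γ * ind (Ez ∩ E3) ω - α * ind (Ez ∩ B3) ω - β * ind (Oy ∩ (Ex ∩ Ez)) ω) := by rw [h]
      _ = γ * (wt ω * ind (Ez ∩ E3) ω) - α * (wt ω * ind (Ez ∩ B3) ω) - β * (wt ω * ind (Oy ∩ (Ex ∩ Ez)) ω) := by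
          ring
  · rw [setIntegral_eq_sum w, setIntegral_eq_sum w, measureReal_eq_sum w (((Ox ∪ Oy) ∩ Ez) ∩ E3),
      measureReal_eq_sum w ((Ox ∩ Ez) ∩ B3), measureReal_eq_sum w (Oy ∩ (Ex ∩ Ez)),
      Finset.mul_sum, Finset.mul_sum, Finset.mul_sum, ← Finset.sum_sub_distrib, ← Finset.sum_sub_distrib,
      ← Finset.sum_sub_distrib]
    refine Finset.sum_congr rfl fun ω _ => ?_
    have h := (pw ω).2.2.2
    calc wt ω * (F (⋃ n ∈ N, openCluster ω n) * ind ((Ox ∪ Oy) ∩ Ez) ω) -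
          wt ω * (F (openCluster ω z) * ind ((Ox ∪ Oy) ∩ Ez) ω)
        = wt ω * ((F (⋃ n ∈ N, openCluster ω n) - F (openCluster ω z)) * ind ((Ox ∪ Oy) ∩ Ez) ω) := by ring
      _ = wt ω * (γ * ind (((Ox ∪ Oy) ∩ Ez) ∩ E3) ω - α * ind ((Ox ∩ Ez) ∩ B3) ω - β * ind (Oy ∩ (Ex ∩ Ez)) ω) := by rw [h]
      _ = γ * (wt ω * ind (((Ox ∪ Oy) ∩ Ez) ∩ E3) ω) - α * (wt ω * ind ((Ox ∩ Ez) ∩ B3) ω) -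
            β * (wt ω * ind (Oy ∩ (Ex ∩ Ez)) ω) := by ring


end HexagonRows

end

end Summit.CriticalPhenomena.PercolationContinuityZ3.Theorems
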